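import Mathlib
import Literature.Analysis.SpecialFunctions.LegendreHilbertBasis
import Literature.Analysis.OperatorTheory.DiagonalPerturbationEigenbasis
import HarnessLib

/-!
# Completeness of the axisymmetric oblate spheroidal harmonics in `L²([-1, 1])`

Topic `Literature/Analysis/SpecialFunctions` (namespace `Literature.Analysis.SpecialFunctions`),
continuing `LegendreHilbertBasis.lean` (the normalised Legendre polynomials `P̃_n` are a Hilbert
basis of `L²([-1,1])`) with the abstract engine
`Literature.Analysis.OperatorTheory.exists_hilbertBasis_diag_add`
(`DiagonalPerturbationEigenbasis.lean`).

Dafermos–Rodnianski–Shlapentokh-Rothman (arXiv:1402.7034 = Ann. of Math. 183 (2016)), §5.2.1: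
for `ν ∈ ℝ` the eigenfunctions `S_{mℓ}(ν, cos θ) e^{imφ}` of the self-adjoint operator
`P(ν) = -(1/sin θ) ∂_θ(sin θ ∂_θ) - ∂_φ²/sin² θ - ν² cos² θ` on `L²(sin θ dθ dφ)` "form a complete
orthonormal basis", with real discrete eigenvalues `λ_{mℓ}(ν)`; for `ν = 0` they reduce to the
spherical harmonics. This file proves the **axisymmetric sector `m = 0`** of this statement, in the
variable `x = cos θ ∈ [-1, 1]` (`∫_0^π |f(cos θ)|² sin θ dθ = ∫_{-1}^1 |f|²`), where
`P(ν)|_{m=0} = L - ν² x²` with the Legendre operator `L = -d/dx (1 - x²) d/dx`: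

* `legendreMul w` — multiplication by a bounded measurable real weight on `L²([-1,1])`
  (`coeFn_legendreMul`, `inner_legendreMul`, norm bound, `isSelfAdjoint_legendreMul`);
* `legendreOp p = -((1 - X²) p')'` on `ℝ[X]`: the symmetric form
  `∫_{-1}^1 (L p) q = ∫_{-1}^1 (1 - x²) p' q'` (`integral_legendreOp_mul`), symmetry, the
  coefficient formula and `deg L p ≤ deg p`, and **Legendre's differential equation**
  `L P_n = n(n+1) P_n` (`legendreOp_legendre`, proved from orthogonality: `L P_n - n(n+1) P_n` has
  degree `< n` and is orthogonal to `P_0, …, P_{n-1}`), whence the diagonal operator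
  `diag(n(n+1))` in the Legendre basis is the Legendre operator on polynomials
  (`inner_legendreL2_legendreOp`);
* `exists_hilbertBasis_oblateSpheroidal_axisym` — **for every real `ν` there is a Hilbert basis
  `(S_j)` of `L²([-1, 1])` of eigenfunctions of `L - ν² x²`** with real eigenvalues `λ_j → +∞`,
  `λ_j ≥ -ν²`, in Legendre coefficients:
  `n(n+1) ⟨P̃_n, S_j⟩ - ν² ⟨P̃_n, x² S_j⟩ = λ_j ⟨P̃_n, S_j⟩` for all `n`;
* `inner_oblateSpheroidal_legendreOp` — the weak eigenfunction equation against polynomial test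
  functions: `⟨S_j, (L - ν² x²) p⟩ = λ_j ⟨S_j, p⟩` for every real polynomial `p`.

The eigenvalue bound printed in DRSR, `λ + ν² ≥ |m|(|m|+1) = 0`, is `-ν² ≤ λ_j`. The
identification of the `S_j` with the smooth solutions of the spheroidal equation regular at both
poles (the shooting eigenfunctions `sphmEig` of `SpheroidalHarmonicEigenfunction.lean`), the sectors
`m ≠ 0` and the assembly over `m` on the sphere are not treated here. Everything is PROVED; no
named facts.

## References

* M. Dafermos, I. Rodnianski, Y. Shlapentokh-Rothman, arXiv:1402.7034 = Ann. of Math. 183 (2016),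
  §5.2.1 (oblate spheroidal harmonics: completeness, eigenvalue bounds).
  [DafermosRodnianskiShlapentokhrothman2014]
* M. Reed, B. Simon, *Methods of Modern Mathematical Physics IV* (1978), Thm. XIII.64.
  [ReedSimonIV1978]
* G. E. Andrews, R. Askey, R. Roy, *Special Functions*, CUP 1999, §2.5 and (6.3.9)/§6.4 (the
  differential equation of the Jacobi/ultraspherical polynomials, `α = β = 0`).
  [AndrewsAskeyRoy1999]
-/

noncomputable section

open MeasureTheory Set Filter Topology Polynomial Literature.Analysis.OperatorTheory
open scoped ENNReal InnerProductSpace ComplexConjugate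

namespace Literature.Analysis.SpecialFunctions

/-! ### Multiplication by a bounded real weight on `L²([-1, 1])` -/

section Mul

variable {w : ℝ → ℝ} {W : ℝ}

/-- A bounded measurable real weight, complexified, is in `L^∞([-1, 1])`. [folklore] -/
theorem memLp_top_weight (hw : Measurable w) (hb : ∀ x, |w x| ≤ W) :
    MemLp (fun x ↦ ((w x : ℝ) : ℂ)) ∞ legendreMeasure :=
  memLp_top_of_bound (Complex.measurable_ofReal.comp hw).aestronglyMeasurable W
    (Eventually.of_forall fun x ↦ by
      rw [Complex.norm_real, Real.norm_eq_abs]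
      exact hb x)

/-- The weight as an element of `L^∞([-1, 1])`. [folklore] -/
def weightLinfty (hw : Measurable w) (hb : ∀ x, |w x| ≤ W) : Lp ℂ ∞ legendreMeasure :=
  (memLp_top_weight hw hb).toLp _

/-- The weight class is represented by `x ↦ w x`. [folklore] -/
theorem coeFn_weightLinfty (hw : Measurable w) (hb : ∀ x, |w x| ≤ W) :
    (weightLinfty hw hb : ℝ → ℂ) =ᵐ[legendreMeasure] fun x ↦ ((w x : ℝ) : ℂ) :=
  MemLp.coeFn_toLp _

/-- `‖w‖_{L^∞} ≤ W`. [folklore] -/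
theorem norm_weightLinfty_le (hw : Measurable w) (hb : ∀ x, |w x| ≤ W) (hW : 0 ≤ W) :
    ‖weightLinfty hw hb‖ ≤ W := by
  rw [weightLinfty, Lp.norm_toLp, eLpNorm_exponent_top]
  have h : eLpNormEssSup (fun x ↦ ((w x : ℝ) : ℂ)) legendreMeasure ≤ ENNReal.ofReal W :=
    eLpNormEssSup_le_of_ae_bound (Eventually.of_forall fun x ↦ by
      rw [Complex.norm_real, Real.norm_eq_abs]
      exact hb x)
  exact (ENNReal.toReal_mono ENNReal.ofReal_ne_top h).trans (by rw [ENNReal.toReal_ofReal hW])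

/-- **The multiplication operator `f ↦ w · f` on `L²([-1, 1])`** by a bounded measurable real
weight (Hölder `L^∞ × L² → L²`). [folklore] -/
def legendreMul (hw : Measurable w) (hb : ∀ x, |w x| ≤ W) :
    Lp ℂ 2 legendreMeasure →L[ℂ] Lp ℂ 2 legendreMeasure :=
  (ContinuousLinearMap.mul ℂ ℂ).holderL legendreMeasure ∞ 2 2 (weightLinfty hw hb)

/-- `(w · f)(x) = w(x) f(x)` a.e. [folklore] -/
theorem coeFn_legendreMul (hw : Measurable w) (hb : ∀ x, |w x| ≤ W) (f : Lp ℂ 2 legendreMeasure) :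
    (legendreMul hw hb f : ℝ → ℂ) =ᵐ[legendreMeasure] fun x ↦ ((w x : ℝ) : ℂ) * f x := by
  rw [legendreMul, ContinuousLinearMap.holderL_apply_apply]
  filter_upwards [(ContinuousLinearMap.mul ℂ ℂ).coeFn_holder (r := 2) (weightLinfty hw hb) f,
    coeFn_weightLinfty hw hb] with x hx hwx
  rw [hx, ContinuousLinearMap.mul_apply', hwx]

/-- `‖w · f‖ ≤ W ‖f‖`. [folklore] -/
theorem norm_legendreMul_apply_le (hw : Measurable w) (hb : ∀ x, |w x| ≤ W) (hW : 0 ≤ W)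
    (f : Lp ℂ 2 legendreMeasure) : ‖legendreMul hw hb f‖ ≤ W * ‖f‖ := by
  rw [legendreMul, ContinuousLinearMap.holderL_apply_apply]
  calc ‖(ContinuousLinearMap.mul ℂ ℂ).holder 2 (weightLinfty hw hb) f‖
      ≤ ‖ContinuousLinearMap.mul ℂ ℂ‖ * ‖weightLinfty hw hb‖ * ‖f‖ :=
        ContinuousLinearMap.norm_holder_apply_apply_le _ _ _
    _ ≤ 1 * W * ‖f‖ := by
        gcongr
        · exact ContinuousLinearMap.opNorm_mul_le _ _
        · exact norm_weightLinfty_le hw hb hW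
    _ = W * ‖f‖ := by rw [one_mul]

/-- `‖(w · )‖ ≤ W`. [folklore] -/
theorem norm_legendreMul_le (hw : Measurable w) (hb : ∀ x, |w x| ≤ W) (hW : 0 ≤ W) :
    ‖legendreMul hw hb‖ ≤ W :=
  ContinuousLinearMap.opNorm_le_bound _ hW (norm_legendreMul_apply_le hw hb hW)

/-- `⟨g, w · f⟩ = ∫_{[-1,1]} conj(g) w f`. [folklore] -/
theorem inner_legendreMul (hw : Measurable w) (hb : ∀ x, |w x| ≤ W)
    (g f : Lp ℂ 2 legendreMeasure) :
    ⟪g, legendreMul hw hb f⟫_ℂ = ∫ x, conj (g x) * (((w x : ℝ) : ℂ) * f x) ∂legendreMeasure := by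
  rw [L2.inner_def]
  refine integral_congr_ae ?_
  filter_upwards [coeFn_legendreMul hw hb f] with x hx
  rw [RCLike.inner_apply, hx, mul_comm]

/-- **Multiplication by a real weight is self-adjoint**: `⟨w f, g⟩ = ⟨f, w g⟩`. [folklore] -/
theorem isSelfAdjoint_legendreMul (hw : Measurable w) (hb : ∀ x, |w x| ≤ W) :
    IsSelfAdjoint (legendreMul hw hb) := by
  rw [ContinuousLinearMap.isSelfAdjoint_iff_isSymmetric]
  intro f g
  change ⟪legendreMul hw hb f, g⟫_ℂ = ⟪f, legendreMul hw hb g⟫_ℂ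
  rw [← inner_conj_symm, inner_legendreMul, inner_legendreMul, ← integral_conj]
  refine integral_congr_ae (Eventually.of_forall fun x ↦ ?_)
  simp only [map_mul, Complex.conj_conj, Complex.conj_ofReal]
  ring

end Mul

/-! ### The weight `x²` -/

/-- `|x²| ≤ 1` is false on `ℝ`, so we use the truncated weight `min (x²) 1`, which agrees with `x²`
on `[-1, 1]`. [folklore] -/
def sqWeight (x : ℝ) : ℝ := min (x ^ 2) 1

/-- `sqWeight` is measurable. [folklore] -/
theorem measurable_sqWeight : Measurable sqWeight :=
  (measurable_id.pow_const 2).min measurable_const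

/-- `|sqWeight x| ≤ 1`. [folklore] -/
theorem abs_sqWeight_le (x : ℝ) : |sqWeight x| ≤ 1 := by
  rw [sqWeight, abs_of_nonneg (le_min (sq_nonneg x) zero_le_one)]
  exact min_le_right _ _

/-- On `[-1, 1]`, `sqWeight x = x²`. [folklore] -/
theorem sqWeight_of_mem {x : ℝ} (hx : x ∈ Icc (-1 : ℝ) 1) : sqWeight x = x ^ 2 := by
  rw [sqWeight, min_eq_left]
  rw [sq_le_one_iff_abs_le_one, abs_le]
  exact ⟨hx.1, hx.2⟩

/-- **Multiplication by `x²` on `L²([-1, 1])`.** [folklore] -/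
def mulSq : Lp ℂ 2 legendreMeasure →L[ℂ] Lp ℂ 2 legendreMeasure :=
  legendreMul measurable_sqWeight abs_sqWeight_le

/-- `(x² · f)(x) = x² f(x)` a.e. on `[-1, 1]`. [folklore] -/
theorem coeFn_mulSq (f : Lp ℂ 2 legendreMeasure) :
    (mulSq f : ℝ → ℂ) =ᵐ[legendreMeasure] fun x ↦ ((x ^ 2 : ℝ) : ℂ) * f x := by
  filter_upwards [coeFn_legendreMul measurable_sqWeight abs_sqWeight_le f,
    ae_legendreMeasure_of_forall_mem (p := fun x ↦ sqWeight x = x ^ 2) fun x hx ↦ sqWeight_of_mem hx]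
    with x hx hsq
  rw [mulSq, hx, hsq]

/-- `⟨g, x² f⟩ = ∫_{[-1,1]} conj(g) x² f`. [folklore] -/
theorem inner_mulSq (g f : Lp ℂ 2 legendreMeasure) :
    ⟪g, mulSq f⟫_ℂ = ∫ x, conj (g x) * (((x ^ 2 : ℝ) : ℂ) * f x) ∂legendreMeasure := by
  rw [L2.inner_def]
  refine integral_congr_ae ?_
  filter_upwards [coeFn_mulSq f] with x hx
  rw [RCLike.inner_apply, hx, mul_comm]

/-- `x² ·` is self-adjoint with norm `≤ 1`. [folklore] -/
theorem isSelfAdjoint_mulSq : IsSelfAdjoint mulSq :=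
  isSelfAdjoint_legendreMul _ _

/-- `‖x² · ‖ ≤ 1`. [folklore] -/
theorem norm_mulSq_le : ‖mulSq‖ ≤ 1 :=
  norm_legendreMul_le _ _ zero_le_one

/-! ### The Legendre differential operator on polynomials -/

/-- **The Legendre operator** `L p = -((1 - X²) p')'` on real polynomials (the `m = 0`, `ν = 0`
angular operator `-(1/sin θ) d/dθ (sin θ d/dθ)` in the variable `x = cos θ`).
[cite: AndrewsAskeyRoy1999, (6.3.9) (α = β = 0)] -/
def legendreOp (p : ℝ[X]) : ℝ[X] := -derivative ((1 - X ^ 2) * derivative p)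

/-- Expanded form: `L p = 2 X p' - p'' + X² p''`. [folklore] -/
theorem legendreOp_eq (p : ℝ[X]) :
    legendreOp p = C 2 * (X ^ 1 * derivative p) - derivative (derivative p) +
      X ^ 2 * derivative (derivative p) := by
  rw [legendreOp, derivative_mul, derivative_sub, derivative_one, derivative_X_pow]
  simp only [Nat.cast_ofNat, pow_one]
  ring

/-- `L` is additive. [folklore] -/
theorem legendreOp_add (p q : ℝ[X]) : legendreOp (p + q) = legendreOp p + legendreOp q := by
  simp only [legendreOp, derivative_add, mul_add, neg_add]

/-- `L` commutes with scalars. [folklore] -/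
theorem legendreOp_C_mul (c : ℝ) (p : ℝ[X]) : legendreOp (C c * p) = C c * legendreOp p := by
  simp only [legendreOp, derivative_mul, derivative_C, zero_mul, zero_add]
  ring

/-- `L` kills constants and `L (p - q) = L p - L q`. [folklore] -/
theorem legendreOp_sub (p q : ℝ[X]) : legendreOp (p - q) = legendreOp p - legendreOp q := by
  simp only [legendreOp, derivative_sub, mul_sub, neg_sub']

/-- **The coefficient formula**: if `p` has no terms of degree `m+1`, `m+2` then
`(L p)_m = m(m+1) p_m` (in general `(L p)_m = m(m+1) p_m - (m+1)(m+2) p_{m+2}`). [folklore] -/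
theorem coeff_legendreOp {p : ℝ[X]} {m : ℕ} (h2 : p.coeff (m + 2) = 0) :
    (legendreOp p).coeff m = m * (m + 1) * p.coeff m := by
  rw [legendreOp_eq]
  simp only [coeff_add, coeff_sub, coeff_C_mul, coeff_X_pow_mul', coeff_derivative]
  rcases m with _ | _ | k
  · norm_num at h2 ⊢
    exact h2
  · norm_num at h2 ⊢
    rw [h2]
  · have h1 : 1 ≤ k + 2 := by omega
    have h2' : 2 ≤ k + 2 := by omega
    simp only [h1, h2', if_true, show k + 2 - 1 = k + 1 by omega, show k + 2 - 2 = k by omega]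
    rw [show k + 2 + 1 + 1 = k + 2 + 2 from rfl, h2]
    push_cast
    ring

/-- **`deg L p ≤ deg p`.** [folklore] -/
theorem natDegree_legendreOp_le (p : ℝ[X]) : (legendreOp p).natDegree ≤ p.natDegree := by
  rw [natDegree_le_iff_coeff_eq_zero]
  intro N hN
  rw [coeff_legendreOp (coeff_eq_zero_of_natDegree_lt (by omega)),
    coeff_eq_zero_of_natDegree_lt hN, mul_zero]

/-- The leading coefficient: `(L p)_d = d(d+1) p_d` for `d = deg p`. [folklore] -/
theorem coeff_legendreOp_natDegree (p : ℝ[X]) :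
    (legendreOp p).coeff p.natDegree = p.natDegree * (p.natDegree + 1) * p.leadingCoeff := by
  rw [coeff_legendreOp (coeff_eq_zero_of_natDegree_lt (by omega)), leadingCoeff]

/-- The polynomial functions are interval integrable (continuity). [folklore] -/
theorem intervalIntegrable_eval_mul (p q : ℝ[X]) (a b : ℝ) :
    IntervalIntegrable (fun x ↦ p.eval x * q.eval x) volume a b :=
  ((p.continuous).mul q.continuous).intervalIntegrable _ _

/-- **The symmetric (Dirichlet) form of the Legendre operator**:
`∫_{-1}^1 (L p) q = ∫_{-1}^1 (1 - x²) p' q'` (one integration by parts; the boundary term carries the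
factor `1 - x²`, which vanishes at `±1`). [folklore] -/
theorem integral_legendreOp_mul (p q : ℝ[X]) :
    ∫ x in (-1 : ℝ)..1, (legendreOp p).eval x * q.eval x =
      ∫ x in (-1 : ℝ)..1, ((1 - X ^ 2) * derivative p).eval x * (derivative q).eval x := by
  have h := integral_derivative_mul ((1 - X ^ 2) * derivative p) q
  have hb : ∀ s : ℝ, s = 1 ∨ s = -1 → ((1 - X ^ 2) * derivative p : ℝ[X]).eval s = 0 := by
    rintro s (rfl | rfl) <;> simp
  rw [hb 1 (Or.inl rfl), hb (-1) (Or.inr rfl), zero_mul, zero_mul, sub_zero, zero_sub] at h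
  have hneg : ∫ x in (-1 : ℝ)..1, (legendreOp p).eval x * q.eval x =
      -∫ x in (-1 : ℝ)..1, (derivative ((1 - X ^ 2) * derivative p)).eval x * q.eval x := by
    rw [← intervalIntegral.integral_neg]
    refine intervalIntegral.integral_congr fun x _ ↦ ?_
    simp only [legendreOp, eval_neg, neg_mul]
  rw [hneg, h, neg_neg]

/-- **Symmetry of `L` on polynomials**: `∫_{-1}^1 (L p) q = ∫_{-1}^1 p (L q)`. [folklore] -/
theorem integral_legendreOp_mul_comm (p q : ℝ[X]) :
    ∫ x in (-1 : ℝ)..1, (legendreOp p).eval x * q.eval x =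
      ∫ x in (-1 : ℝ)..1, p.eval x * (legendreOp q).eval x := by
  rw [integral_legendreOp_mul]
  have h := integral_legendreOp_mul q p
  have h' : ∫ x in (-1 : ℝ)..1, p.eval x * (legendreOp q).eval x =
      ∫ x in (-1 : ℝ)..1, (legendreOp q).eval x * p.eval x :=
    intervalIntegral.integral_congr fun x _ ↦ mul_comm _ _
  rw [h', h]
  refine intervalIntegral.integral_congr fun x _ ↦ ?_
  simp only [eval_mul, eval_sub, eval_one, eval_pow, eval_X]
  ring

/-- **Legendre's differential equation** `L P_n = n(n+1) P_n`, i.e.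
`((1 - x²) P_n')' + n(n+1) P_n = 0`. Proof from orthogonality alone: `R = L P_n - n(n+1) P_n` has
degree `≤ n - 1` (the degree-`n` coefficients cancel, `coeff_legendreOp_natDegree`) and is
orthogonal to `P_k`, `k < n`, since `∫ (L P_n) P_k = ∫ P_n (L P_k) = 0` (`deg L P_k ≤ k < n`); hence
`R = 0` (`eq_zero_of_orthogonal_legendre`). [cite: AndrewsAskeyRoy1999, (6.3.9) (α = β = 0)] -/
theorem legendreOp_legendre (n : ℕ) :
    legendreOp (legendre n) = C ((n : ℝ) * (n + 1)) * legendre n := by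
  rcases Nat.eq_zero_or_pos n with rfl | hn
  · simp [legendreOp, legendre_zero]
  set R : ℝ[X] := legendreOp (legendre n) - C ((n : ℝ) * (n + 1)) * legendre n with hR
  suffices hR0 : R = 0 by rwa [hR, sub_eq_zero] at hR0
  -- degree `≤ n - 1`
  have hdegL : (legendreOp (legendre n)).natDegree ≤ n :=
    (natDegree_legendreOp_le _).trans (natDegree_legendre n).le
  have hdeg : R.natDegree ≤ n - 1 := by
    rw [natDegree_le_iff_coeff_eq_zero]
    intro N hN
    rw [hR, coeff_sub, coeff_C_mul]
    rcases (show n ≤ N by omega).eq_or_lt with h | h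
    · subst h
      have hc := coeff_legendreOp_natDegree (legendre n)
      rw [natDegree_legendre, leadingCoeff, natDegree_legendre] at hc
      rw [hc, sub_self]
    · rw [coeff_eq_zero_of_natDegree_lt (hdegL.trans_lt h),
        coeff_eq_zero_of_natDegree_lt ((natDegree_legendre n).le.trans_lt h), mul_zero, sub_zero]
  -- orthogonality to `P_k`, `k ≤ n - 1`
  refine eq_zero_of_orthogonal_legendre hdeg fun k hk ↦ ?_
  have hkn : k < n := by omega
  have hsplit : ∫ x in (-1 : ℝ)..1, R.eval x * (legendre k).eval x =
      (∫ x in (-1 : ℝ)..1, (legendreOp (legendre n)).eval x * (legendre k).eval x) -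
        (n : ℝ) * (n + 1) * ∫ x in (-1 : ℝ)..1, (legendre n).eval x * (legendre k).eval x := by
    rw [← intervalIntegral.integral_const_mul, ← intervalIntegral.integral_sub
      (intervalIntegrable_eval_mul _ _ _ _) ((intervalIntegrable_eval_mul _ _ _ _).const_mul _)]
    refine intervalIntegral.integral_congr fun x _ ↦ ?_
    simp only [hR, eval_sub, eval_mul, eval_C]
    ring
  rw [hsplit, integral_legendre_mul_legendre_eq_zero hkn, mul_zero, sub_zero,
    integral_legendreOp_mul_comm]
  -- `∫ P_n (L P_k) = 0` since `deg L P_k ≤ k < n`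
  exact integral_legendre_mul_eq_zero
    ((degree_le_of_natDegree_le ((natDegree_legendreOp_le _).trans (natDegree_legendre k).le)).trans_lt
      (by exact_mod_cast hkn))

/-- **The diagonal operator `diag(n(n+1))` in the Legendre basis is the Legendre operator**: for every
real polynomial `p`, `⟨P̃_n, L p⟩ = n(n+1) ⟨P̃_n, p⟩` (symmetry of `L` and `L P̃_n = n(n+1) P̃_n`).
[folklore] -/
theorem inner_legendreL2_legendreOp (n : ℕ) (p : ℝ[X]) :
    ⟪legendreL2 n, polynomialL2 (legendreOp p)⟫_ℂ =
      ((n : ℝ) * (n + 1) : ℝ) * ⟪legendreL2 n, polynomialL2 p⟫_ℂ := by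
  -- both sides are real interval integrals
  have hint : ∀ q : ℝ[X], ⟪legendreL2 n, polynomialL2 q⟫_ℂ =
      ((legendreNormConst n * ∫ x in (-1 : ℝ)..1, (legendre n).eval x * q.eval x : ℝ) : ℂ) := by
    intro q
    rw [inner_legendreL2_left]
    have h : ∫ x, conj (legendreFn n x) * (polynomialL2 q : ℝ → ℂ) x ∂legendreMeasure =
        ∫ x, ((legendreNormConst n * ((legendre n).eval x * q.eval x) : ℝ) : ℂ) ∂legendreMeasure := by
      refine integral_congr_ae ?_
      filter_upwards [coeFn_polynomialL2 q] with x hx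
      rw [hx, conj_legendreFn, legendreFn_apply, ← Complex.ofReal_mul, mul_assoc]
    rw [h, integral_complex_ofReal, integral_legendreMeasure_eq_intervalIntegral,
      intervalIntegral.integral_const_mul]
  rw [hint, hint, ← Complex.ofReal_mul]
  congr 1
  have key : ∫ x in (-1 : ℝ)..1, (legendre n).eval x * (legendreOp p).eval x =
      (n : ℝ) * (n + 1) * ∫ x in (-1 : ℝ)..1, (legendre n).eval x * p.eval x := by
    calc ∫ x in (-1 : ℝ)..1, (legendre n).eval x * (legendreOp p).eval x
        = ∫ x in (-1 : ℝ)..1, (legendreOp p).eval x * (legendre n).eval x :=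
          intervalIntegral.integral_congr fun x _ ↦ mul_comm _ _
      _ = ∫ x in (-1 : ℝ)..1, p.eval x * (legendreOp (legendre n)).eval x :=
          integral_legendreOp_mul_comm p (legendre n)
      _ = ∫ x in (-1 : ℝ)..1, (n : ℝ) * (n + 1) * ((legendre n).eval x * p.eval x) := by
          refine intervalIntegral.integral_congr fun x _ ↦ ?_
          simp only [legendreOp_legendre, eval_mul, eval_C]
          ring
      _ = (n : ℝ) * (n + 1) * ∫ x in (-1 : ℝ)..1, (legendre n).eval x * p.eval x :=
          intervalIntegral.integral_const_mul _ _
  rw [key]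
  ring

/-! ### The axisymmetric oblate spheroidal eigenbasis -/

/-- The levels `n(n+1)` tend to `+∞`. [folklore] -/
theorem tendsto_legendreLevel : Tendsto (fun n : ℕ ↦ (n : ℝ) * (n + 1)) cofinite atTop := by
  rw [Nat.cofinite_eq_atTop]
  refine tendsto_atTop_mono (fun n ↦ ?_) tendsto_natCast_atTop_atTop
  nlinarith [n.cast_nonneg (α := ℝ)]

/-- **Completeness of the axisymmetric oblate spheroidal harmonics.** For every real `ν` there are
a Hilbert basis `(S_j)_{j ∈ s}` of `L²([-1, 1])` (indexed by a subset `s`, `S_j = j`) and real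
eigenvalues `λ_j` with `λ_j → +∞` along the cofinite filter and `λ_j ≥ -ν²` (i.e.
`λ + ν² ≥ |m|(|m|+1)` with `m = 0`), such that each `S_j` is an eigenfunction of the axisymmetric
oblate spheroidal operator `P(ν)|_{m=0} = L - ν² x²`, `L = -d/dx(1-x²)d/dx`, with eigenvalue
`λ_j`, in Legendre coefficients: `n(n+1) ⟨P̃_n, S_j⟩ - ν² ⟨P̃_n, x² S_j⟩ = λ_j ⟨P̃_n, S_j⟩` for all
`n` (the operator `diag(n(n+1))` being `L`, `inner_legendreL2_legendreOp`). This is the `m = 0`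
sector of "the eigenfunctions of `P(ν)` form a complete orthonormal basis of `L²(sin θ dθ dφ)`"
(DRSR §5.2.1), via `x = cos θ`.
[cite: DafermosRodnianskiShlapentokhrothman2014, §5.2.1] -/
theorem exists_hilbertBasis_oblateSpheroidal_axisym (ν : ℝ) :
    ∃ (s : Set (Lp ℂ 2 legendreMeasure)) (S : HilbertBasis s ℂ (Lp ℂ 2 legendreMeasure))
      (lam : s → ℝ), ⇑S = ((↑) : s → Lp ℂ 2 legendreMeasure) ∧ Tendsto lam cofinite atTop ∧
      (∀ j, -ν ^ 2 ≤ lam j) ∧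
      ∀ j (n : ℕ), (((n : ℝ) * (n + 1) : ℝ) : ℂ) * ⟪legendreL2 n, S j⟫_ℂ -
        ((ν ^ 2 : ℝ) : ℂ) * ⟪legendreL2 n, mulSq (S j)⟫_ℂ = (lam j : ℂ) * ⟪legendreL2 n, S j⟫_ℂ := by
  -- the perturbation `B = -ν² x²`, self-adjoint with `‖B‖ ≤ ν²`
  set B : Lp ℂ 2 legendreMeasure →L[ℂ] Lp ℂ 2 legendreMeasure := ((-ν ^ 2 : ℝ) : ℂ) • mulSq with hB
  have hBsa : IsSelfAdjoint B := by
    rw [hB]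
    exact IsSelfAdjoint.smul (by rw [isSelfAdjoint_iff, Complex.star_def, Complex.conj_ofReal])
      isSelfAdjoint_mulSq
  have hBnorm : ‖B‖ ≤ ν ^ 2 := by
    rw [hB, norm_smul, Complex.norm_real, Real.norm_eq_abs, abs_neg, abs_of_nonneg (sq_nonneg ν)]
    calc ν ^ 2 * ‖mulSq‖ ≤ ν ^ 2 * 1 := mul_le_mul_of_nonneg_left norm_mulSq_le (sq_nonneg ν)
      _ = ν ^ 2 := mul_one _
  obtain ⟨s, S, lam, hS, htend, hlow, heq⟩ := exists_hilbertBasis_diag_add legendreBasis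
    (fun n : ℕ ↦ (n : ℝ) * (n + 1)) 0 (fun n ↦ by positivity) tendsto_legendreLevel B hBsa
  refine ⟨s, S, lam, hS, htend, fun j ↦ ?_, fun j n ↦ ?_⟩
  · have := hlow j
    linarith
  · have h := heq j n
    rw [legendreBasis_apply, hB] at h
    simp only [FunLike.coe_smul, Pi.smul_apply, inner_smul_right] at h
    push_cast at h ⊢
    linear_combination h

/-- **The weak eigenfunction equation against polynomial test functions.** With `S_j`, `λ_j` as in
`exists_hilbertBasis_oblateSpheroidal_axisym`: for every real polynomial `p`,
`⟨S_j, L p⟩ - ν² ⟨S_j, x² p⟩ = λ_j ⟨S_j, p⟩`, i.e. `S_j` is a distributional solution of the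
axisymmetric oblate spheroidal equation `-((1-x²)S')' - ν² x² S = λ S` on `(-1, 1)` (Parseval in the
Legendre basis, `inner_legendreL2_legendreOp`, and the symmetry of `x²·`). [folklore] -/
theorem inner_oblateSpheroidal_legendreOp {ν : ℝ} {S : Lp ℂ 2 legendreMeasure} {lam : ℝ}
    (heq : ∀ n : ℕ, (((n : ℝ) * (n + 1) : ℝ) : ℂ) * ⟪legendreL2 n, S⟫_ℂ -
      ((ν ^ 2 : ℝ) : ℂ) * ⟪legendreL2 n, mulSq S⟫_ℂ = (lam : ℂ) * ⟪legendreL2 n, S⟫_ℂ) (p : ℝ[X]) :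
    ⟪S, polynomialL2 (legendreOp p)⟫_ℂ - ((ν ^ 2 : ℝ) : ℂ) * ⟪S, mulSq (polynomialL2 p)⟫_ℂ =
      (lam : ℂ) * ⟪S, polynomialL2 p⟫_ℂ := by
  have hsym : ∀ u v : Lp ℂ 2 legendreMeasure, ⟪mulSq u, v⟫_ℂ = ⟪u, mulSq v⟫_ℂ :=
    fun u v ↦ (ContinuousLinearMap.isSelfAdjoint_iff_isSymmetric.1 isSelfAdjoint_mulSq) u v
  -- Parseval: `⟨u, g⟩ = Σ_n ⟨u, P̃_n⟩ ⟨P̃_n, g⟩`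
  have hP : ∀ u g : Lp ℂ 2 legendreMeasure,
      HasSum (fun n ↦ ⟪u, legendreL2 n⟫_ℂ * ⟪legendreL2 n, g⟫_ℂ) ⟪u, g⟫_ℂ := fun u g ↦ by
    have h := legendreBasis.hasSum_inner_mul_inner u g
    simp only [legendreBasis_apply] at h
    exact h
  rw [← hsym S (polynomialL2 p)]
  have h1 := hP S (polynomialL2 (legendreOp p))
  have h2 := (hP (mulSq S) (polynomialL2 p)).mul_left (((ν ^ 2 : ℝ) : ℂ))
  have h3 := (hP S (polynomialL2 p)).mul_left (lam : ℂ)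
  have h12 : HasSum (fun n ↦ ⟪S, legendreL2 n⟫_ℂ * ⟪legendreL2 n, polynomialL2 (legendreOp p)⟫_ℂ -
      ((ν ^ 2 : ℝ) : ℂ) * (⟪mulSq S, legendreL2 n⟫_ℂ * ⟪legendreL2 n, polynomialL2 p⟫_ℂ))
      (⟪S, polynomialL2 (legendreOp p)⟫_ℂ - ((ν ^ 2 : ℝ) : ℂ) * ⟪mulSq S, polynomialL2 p⟫_ℂ) :=
    h1.sub h2
  -- termwise it is the conjugate of the coefficient equation, times `⟨P̃_n, p⟩`
  have key : (fun n ↦ ⟪S, legendreL2 n⟫_ℂ * ⟪legendreL2 n, polynomialL2 (legendreOp p)⟫_ℂ -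
      ((ν ^ 2 : ℝ) : ℂ) * (⟪mulSq S, legendreL2 n⟫_ℂ * ⟪legendreL2 n, polynomialL2 p⟫_ℂ)) =
      fun n ↦ (lam : ℂ) * (⟪S, legendreL2 n⟫_ℂ * ⟪legendreL2 n, polynomialL2 p⟫_ℂ) := by
    funext n
    rw [inner_legendreL2_legendreOp]
    have hc := congrArg conj (heq n)
    simp only [map_sub, map_mul, Complex.conj_ofReal, inner_conj_symm] at hc
    linear_combination ⟪legendreL2 n, polynomialL2 p⟫_ℂ * hc
  rw [key] at h12
  exact h12.unique h3

end Literature.Analysis.SpecialFunctions
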